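import Literature.AlgebraicGeometry.AbelianSchemes.AbelianSchemeDualTransportSlice
import Literature.AlgebraicGeometry.AbelianVarieties.LineBundleTensorPower
import Literature.AlgebraicGeometry.AbelianVarieties.HomogeneousLineBundleDivisor
import Literature.AlgebraicGeometry.Modules.PullbackFrame
import Literature.AlgebraicGeometry.Modules.RankOneModuleDivisorDictionary
import HarnessLib

/-!
# `λ̄' = Λ(𝒪(e_s^*Θ))`: the `IsLambdaOfAt` transport along `(e, Ĥ_e)` (the module-algebra half of (c-ii-T); sequel of
# ★ `AbelianSchemeDualTransportSlice`)

Topic `AlgebraicGeometry/AbelianSchemes`; namespace `Literature.AlgebraicGeometry.AbelianSchemes.AbelianSchemeOver.DualPair`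
(two general module lemmas in `Literature.AlgebraicGeometry.Modules`).  Cell hodgecm-mathlib (D-0151), rung-0 ladder /
M1PRIME-DAG **W3c (c-ii-T)** — the `IsLambdaOfAt` witness of the transported polarisation `lam₂ := H⁻¹ ≫ λσ ≫ Ĥ` that
B-p03's λ-clause (G5-core ★ `AbelianVarietyPolarisationRigidity`) consumes — over ★ `AbelianSchemeDualTransportSlice`
(`lamTransport`, `nonempty_pullback_sliceAt_lamTransport_iso_of_isLambdaOfAt`), ★ `LineBundleTensorPower`
(`nonempty_pullback_tensorObj_iso`, `nonempty_pullback_dual_iso`), ★ `HomogeneousLineBundleDivisor`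
(`detClass_lineBundle_toUnitCocycle`), ★ `PullbackFrame` (`detClass_pullback`), ★ `RankOneModuleDivisorDictionary`
(`CartierDivisor.cechClass_pullback`) and ★ `AbelianVarietyWeilPairingPullback` (`translation_left_comp_toSchemeHom`).
THEOREMS ONLY; no structure, no named fact, no instance, no `sorry`; books 0.  HC_CM is proved only modulo the printed
citations until rung 0 closes.

## What is proved
* `Modules.nonempty_pullback_lineBundle_toUnitCocycle_iso` — **`g^*𝒪(D) ≅ 𝒪(g^*D)`** for a dominant morphism of integral
  schemes ([GortzWedhorn2020, Def. 11.49, p. 392]; by determinant classes: `[g^*𝒪(D)] = g^*[D] = [𝒪(g^*D)]`);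
* `Modules.nonempty_dual_congr` — `M ≅ M' ⟹ M^∨ ≅ M'^∨` for line bundles (`[M^∨] = [M]⁻¹`);
* `isIso_toSchemeHom_of_iso` / `isDominant_toSchemeHom_fibreIsoOfIso` — the fibre isomorphism is dominant (needed to
  pull the Cartier divisor back);
* **`isLambdaOfAt_lamTransport`** — if `λ̄ = Λ(𝒪(Θ))` at `s` on the `A`-side then, for `e' = e⁻¹`,
  `λ̄' = Λ(𝒪(e_s^*Θ))` at `s` on the `A'`-side, `λ' = lamTransport D D' e e' λ = e ≫ λ ≫ Ĥ_{e'}`: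
  `𝒫'|_{A'_s × {λ̄'(P')}} ≅ e_s^*(t_{e_s P'}^*𝒪(Θ) ⊗ 𝒪(Θ)^∨) ≅ t_{P'}^*𝒪(e_s^*Θ) ⊗ 𝒪(e_s^*Θ)^∨`
  ([MumfordFogartyKirwan1994] Def. 6.2 transported through an isomorphism of triples, Def. 7.3 along `𝟙`).

## References
* [MumfordFogartyKirwan1994] D. Mumford, J. Fogarty, F. Kirwan, *Geometric Invariant Theory*, 3rd ed. (1994), Ch. 6 §2
  Definitions 6.2–6.3 (p. 120), Ch. 7 §2 Definition 7.3 (p. 130).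
* [GortzWedhorn2020] U. Görtz, T. Wedhorn, *Algebraic Geometry I*, 2nd ed. (2020), Def. 11.49 / Prop. 11.50 (p. 392)
  (`g^*𝒪(D) ≅ 𝒪(g^*D)`), Prop. 11.21 (p. 374).
* [Hartshorne1977] R. Hartshorne, *Algebraic Geometry* (1977), II Ex. 6.8, III Ex. 4.5 (`Pic ≅ Ȟ¹(𝒪^×)`, pull-back).
-/

set_option autoImplicit false

universe u

open CategoryTheory CategoryTheory.Limits AlgebraicGeometry MonoidalCategory

noncomputable section

namespace Literature.AlgebraicGeometry.Modules

open Literature.AlgebraicGeometry.Motives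

/-- **`g^*𝒪_Y(D) ≅ 𝒪_{Y'}(g^*D)`** for a dominant morphism `g : Y' → Y` of integral schemes — both are line bundles and
`[g^*𝒪(D)] = g^*[𝒪(D)] = g^*[D] = [g^*D] = [𝒪(g^*D)]` in `Ȟ¹(Y', 𝒪^×)` (★ `detClass_pullback`, ★
`detClass_lineBundle_toUnitCocycle`, ★ `CartierDivisor.cechClass_pullback`, ★ `nonempty_iso_iff_detClass_eq`).
[cite: GortzWedhorn2020, Def. 11.49 and Prop. 11.50 (b) (p. 392)] [cite: Hartshorne1977, III Ex. 4.5] -/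
theorem nonempty_pullback_lineBundle_toUnitCocycle_iso {Y Y' : Scheme.{u}} [IsIntegral Y] [IsIntegral Y']
    (g : Y' ⟶ Y) [IsDominant g] (D : CartierDivisor Y) :
    Nonempty ((Scheme.Modules.pullback g).obj (Modules.lineBundle D.toUnitCocycle) ≅
      Modules.lineBundle (D.pullback g).toUnitCocycle) := by
  have h₁ : HasRank (Modules.lineBundle D.toUnitCocycle) 1 := UnitCocycle.hasRank_lineBundle _
  have h₁' : HasRank (Modules.lineBundle (D.pullback g).toUnitCocycle) 1 := UnitCocycle.hasRank_lineBundle _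
  refine (nonempty_iso_iff_detClass_eq (hasRank_pullback g h₁) h₁'
    (D.toUnitCocycle.isFiniteLocallyFree_lineBundle.pullback g)
    (D.pullback g).toUnitCocycle.isFiniteLocallyFree_lineBundle).2 ?_
  rw [detClass_pullback g D.toUnitCocycle.isFiniteLocallyFree_lineBundle, detClass_lineBundle_toUnitCocycle,
    detClass_lineBundle_toUnitCocycle, CartierDivisor.cechClass_pullback]

/-- `M ≅ M' ⟹ M^∨ ≅ M'^∨` for line bundles (`[M^∨] = [M]⁻¹ = [M']⁻¹ = [M'^∨]`). [cite: Hartshorne1977, II Ex. 5.16 (e) and III Ex. 4.5] -/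
theorem nonempty_dual_congr {X : Scheme.{u}} {M M' : X.Modules} (i : M ≅ M') (hM : HasRank M 1) :
    Nonempty (Modules.dual M ≅ Modules.dual M') := by
  have hM' : HasRank M' 1 := hasRank_of_iso i hM
  refine (nonempty_iso_iff_detClass_eq (hasRank_dual hM) (hasRank_dual hM')
    (isFiniteLocallyFree_dual (HasRank.isFiniteLocallyFree' hM))
    (isFiniteLocallyFree_dual (HasRank.isFiniteLocallyFree' hM'))).2 ?_
  rw [detClass_dual (HasRank.isFiniteLocallyFree' hM), detClass_dual (HasRank.isFiniteLocallyFree' hM'),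
    detClass_eq_of_iso i (HasRank.isFiniteLocallyFree' hM) (HasRank.isFiniteLocallyFree' hM')]

end Literature.AlgebraicGeometry.Modules

namespace Literature.AlgebraicGeometry.AbelianSchemes

namespace AbelianSchemeOver

open Literature.AlgebraicGeometry.Motives Literature.AlgebraicGeometry.Modules
open Literature.AlgebraicGeometry.AbelianVarieties
open scoped MonObj

/-- The underlying scheme morphism of an isomorphism of abelian varieties is an isomorphism. [folklore → ] [cite: GortzWedhorn2020, Section (4.7) (p. 135)] -/
theorem isIso_toSchemeHom_of_iso {K : Type u} [Field K] {B C : AbelianVariety K} (φ : B ≅ C) :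
    IsIso (AbelianVariety.Hom.toSchemeHom φ.hom) :=
  ⟨⟨AbelianVariety.Hom.toSchemeHom φ.inv, congrArg AbelianVariety.Hom.toSchemeHom φ.hom_inv_id,
    congrArg AbelianVariety.Hom.toSchemeHom φ.inv_hom_id⟩⟩

variable {S : Scheme.{u}} {A A' : AbelianSchemeOver S} (e : A'.X ≅ A.X) [IsMonHom e.hom]
  {Ω : Type u} [Field Ω] (s : Spec (.of Ω) ⟶ S)

/-- The fibre isomorphism `e_s : A'_s ≅ A_s` is dominant on underlying schemes (an isomorphism). [cite: GortzWedhorn2020, Section (4.7) (p. 135)] -/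
theorem isDominant_toSchemeHom_fibreIsoOfIso :
    IsDominant (AbelianVariety.Hom.toSchemeHom (fibreIsoOfIso e s).hom) := by
  haveI := isIso_toSchemeHom_of_iso (fibreIsoOfIso e s)
  infer_instance

namespace DualPair

variable (D : A.DualPair) (D' : A'.DualPair) (e' : A.X ≅ A'.X) [IsMonHom e'.hom] (lam : A.X ⟶ D.hat.X)

/-- **`λ̄' = Λ(𝒪(e_s^*Θ))` — the `IsLambdaOfAt` transport along `(e, Ĥ_e)`**: if `λ̄ = Λ(𝒪(Θ))` at `s` for `λ : A → Â`,
then the transported `λ' = e ≫ λ ≫ Ĥ_{e'} : A' → Â'` (`e' = e⁻¹`) satisfies `λ̄' = Λ(𝒪(e_s^*Θ))` at `s`, where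
`e_s = fibreIsoOfIso e s : A'_s ≅ A_s` and `e_s^*Θ = Θ.pullback`.  Chain: `𝒫'|_{A'_s × {λ̄'(P')}} ≅
e_s^*(t_{e_s P'}^*𝒪(Θ) ⊗ 𝒪(Θ)^∨)` (★ `nonempty_pullback_sliceAt_lamTransport_iso_of_isLambdaOfAt`) `≅ e_s^*t_{e_s P'}^*𝒪(Θ) ⊗
(e_s^*𝒪(Θ))^∨` (★ `nonempty_pullback_tensorObj_iso`, ★ `nonempty_pullback_dual_iso`) `≅ t_{P'}^*𝒪(e_s^*Θ) ⊗ 𝒪(e_s^*Θ)^∨`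
(`e_s ∘ t_{P'} = t_{e_s P'} ∘ e_s`, ★ `translation_left_comp_toSchemeHom`; `e_s^*𝒪(Θ) ≅ 𝒪(e_s^*Θ)`).
[cite: MumfordFogartyKirwan1994, Ch. 6 §2 Definition 6.2 (p. 120) and Ch. 7 §2 Definition 7.3 (p. 130)] -/
theorem isLambdaOfAt_lamTransport (he' : e'.hom = e.inv)
    [IsDominant (AbelianVariety.Hom.toSchemeHom (fibreIsoOfIso e s).hom)]
    {Θ : CartierDivisor (A.fibre s).toAbelianVariety.X.left} (h : A.IsLambdaOfAt s D lam Θ) :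
    A'.IsLambdaOfAt s D' (lamTransport D D' e e' lam)
      (Θ.pullback (AbelianVariety.Hom.toSchemeHom (fibreIsoOfIso e s).hom)) := by
  intro P'
  have hL : HasRank (A.lineBundleOfDivisor s Θ) 1 := A.hasRank_lineBundleOfDivisor s Θ
  obtain ⟨i₁⟩ := nonempty_pullback_sliceAt_lamTransport_iso_of_isLambdaOfAt D D' e e' lam s he' h P'
  obtain ⟨i₂⟩ := nonempty_pullback_tensorObj_iso (AbelianVariety.Hom.toSchemeHom (fibreIsoOfIso e s).hom)
    (hasRank_pullback _ hL) (hasRank_dual hL)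
    (M := (Scheme.Modules.pullback ((A.fibre s).toAbelianVariety.translation
      (AlgPoints.map (fibreIsoOfIso e s).hom.hom.hom.hom P')).left).obj (A.lineBundleOfDivisor s Θ))
    (N := Modules.dual (A.lineBundleOfDivisor s Θ))
  obtain ⟨i₃⟩ := nonempty_pullback_dual_iso (AbelianVariety.Hom.toSchemeHom (fibreIsoOfIso e s).hom) hL
  obtain ⟨ℓ⟩ := nonempty_pullback_lineBundle_toUnitCocycle_iso (AbelianVariety.Hom.toSchemeHom (fibreIsoOfIso e s).hom) Θ
  obtain ⟨d⟩ := nonempty_dual_congr ℓ (hasRank_pullback _ hL)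
  have i₄ : (Scheme.Modules.pullback (AbelianVariety.Hom.toSchemeHom (fibreIsoOfIso e s).hom)).obj
        ((Scheme.Modules.pullback ((A.fibre s).toAbelianVariety.translation
          (AlgPoints.map (fibreIsoOfIso e s).hom.hom.hom.hom P')).left).obj (A.lineBundleOfDivisor s Θ)) ≅
      (Scheme.Modules.pullback ((A'.fibre s).toAbelianVariety.translation P').left).obj
        ((Scheme.Modules.pullback (AbelianVariety.Hom.toSchemeHom (fibreIsoOfIso e s).hom)).obj
          (A.lineBundleOfDivisor s Θ)) :=
    (Scheme.Modules.pullbackComp _ _).app _ ≪≫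
      (Scheme.Modules.pullbackCongr (AbelianVariety.translation_left_comp_toSchemeHom (fibreIsoOfIso e s).hom P').symm).app _ ≪≫
      ((Scheme.Modules.pullbackComp _ _).app _).symm
  exact ⟨i₁ ≪≫ i₂ ≪≫ tensorMapIso (i₄ ≪≫ (Scheme.Modules.pullback _).mapIso ℓ) (i₃ ≪≫ d)⟩

/-- The same with the dominance instance supplied (`isDominant_toSchemeHom_fibreIsoOfIso`). [cite: MumfordFogartyKirwan1994, Ch. 6 §2 Definition 6.2 (p. 120)] -/
theorem isLambdaOfAt_lamTransport' (he' : e'.hom = e.inv)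
    {Θ : CartierDivisor (A.fibre s).toAbelianVariety.X.left} (h : A.IsLambdaOfAt s D lam Θ) :
    haveI := isDominant_toSchemeHom_fibreIsoOfIso e s
    A'.IsLambdaOfAt s D' (lamTransport D D' e e' lam)
      (Θ.pullback (AbelianVariety.Hom.toSchemeHom (fibreIsoOfIso e s).hom)) := by
  haveI := isDominant_toSchemeHom_fibreIsoOfIso e s
  exact isLambdaOfAt_lamTransport e s D D' e' lam he' h

end DualPair

end AbelianSchemeOver

end Literature.AlgebraicGeometry.AbelianSchemes

end
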